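import Summits.AtomisticToContinuum.HydrodynamicLimit.Theses.OneFlightGossipEngine
import Summits.AtomisticToContinuum.HydrodynamicLimit.Theses.TwoClocks
import HarnessLib

/-!
# Crux-ideate sketch (ideator 2, round 1) for crux stmt-AtomisticToContinuum-17691
`OneFlightGossipEngine.LocalClampedTransferLDAlongFamilies` (LCT, the repaired collisional node).

Card `shrinking-window-cell-transfer`: typed first lemma `MoverCensus` (provable now: Jensen in
time + Tonelli + a Hölder exponent `p = 1 + (N+1)^{-1/3}` against the constant-profile Gibbs law +
Maxwellian tails), the typed TRANSFER TARGET `UniformEquilibriumClampedTransferLD` (C⁺ = TwoClocks'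
crux C′ = `ClampedTransferWindowLD`, stmt-16623, made uniform over a compact box of
(reduced density, temperature, drift, window multiplier), flow innermost), and the two implication
shapes the line would register. Nothing here is proved; every `def` is a `Prop`.
-/

noncomputable section

namespace Summit.AtomisticToContinuum.HydrodynamicLimit.Cruxes.LocalClampedTransferLDAlongFamilies.IdeatorTwo

open scoped BigOperators Classical
open MeasureTheory Set
open Literature.MathematicalPhysics.KineticTheory Literature.Analysis.FluidPDE Literature.Analysis.FunctionSpaces
open Summit.AtomisticToContinuum.HydrodynamicLimit.Theses

/-- **First lemma (MoverCensus).** Along any jointly continuous positive profile family and for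
every macroscopic distance `d > 0`, multiplier `lam ≥ 0` and tolerance `δ > 0`: for `N ≥ N₀` the
number of particles whose window path length `∫₀ʷ ‖vᵢ(r)‖ dr` reaches `d` during the kinetic window
`w = τ (N+1)^{-1/3}` has exponential moment `≤ e^{δ(N+1)}` under the local Gibbs law `λ^N_s`,
uniformly in `s ∈ [0,t₁]`. (At every large-deviation scale only `o(N)` particles move a
macroscopic distance, because `w → 0`: a mover needs time-averaged speed `≥ d(N+1)^{1/3}/τ → ∞`.)
Proof route: `𝟙{avg ‖vᵢ‖ ≥ u} ≤ (2/u)·avg(‖vᵢ‖𝟙{‖vᵢ‖ ≥ u/2})`, Jensen in time + Tonelli, Hölder with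
exponent `p = 1 + (N+1)^{-1/3}` against the constant-profile Gibbs law (flow-invariant,
`measurePreserving_flow_localGibbsLaw_const`; Rényi divergence `(N+1)·O(1)` in closed form since
velocity fibres are Gaussian), and the Maxwellian tail `E[e^{(2q lam/u)‖v‖}; ‖v‖ ≥ u/2] ≤ e^{-u²/(16θ)}·C`
with `q ≍ (N+1)^{1/3} ≤ u`. [folklore] -/
def MoverCensus : Prop :=
  ∀ (t₁ : ℝ) (a θ₀ : ℝ → T3 → ℝ) (u₀ : ℝ → T3 → V3),
    Continuous (Function.uncurry a) → Continuous (Function.uncurry θ₀) →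
    Continuous (Function.uncurry u₀) → (∀ s x, 0 < a s x) → (∀ s x, 0 < θ₀ s x) →
    ∀ σ : ℝ, 0 < σ → σ < 1 / 2 →
    ∀ Φ : (N : ℕ) → HardSphereFlow (Torus.geometry (Fin 3)) (hsDiameter σ N) (N + 1),
    ∀ (τ d lam δ : ℝ), 0 < τ → 0 < d → 0 ≤ lam → 0 < δ →
    ∃ N₀ : ℕ, ∀ N : ℕ, N₀ ≤ N → ∀ s ∈ Set.Icc 0 t₁,
      (let w : ℝ := τ * ((N : ℝ) + 1) ^ (-(1 / 3 : ℝ))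
       let P := localGibbsLaw σ (a s) (u₀ s) (θ₀ s) N (Φ N)
       let movers := fun (z : Config (N + 1) (Fin 3) T3) =>
         ∑ i : Fin (N + 1), (if d ≤ ∫ r in (0 : ℝ)..w, ‖((Φ N).flow r z i).2‖ then (1 : ℝ) else 0)
       ∫⁻ z, ENNReal.ofReal (Real.exp (lam * movers z)) ∂P ≤
         ENNReal.ofReal (Real.exp (δ * ((N : ℝ) + 1))))

/-- **Transfer target C⁺ (UniformEquilibriumClampedTransferLD).** TwoClocks' crux C′
(`ClampedTransferWindowLD`, stmt-16623: transfer-clamped collisional window LD at GLOBAL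
equilibrium, the constant-family rung of this crux) with its thresholds `V₀, β₀, τ₀, N₀` UNIFORM over
a compact box of parameters — reduced density `σ ∈ [σlo, σhi]` (with `σhi³ ≤ η₀`), temperature
`θ₀ ∈ [θlo, θhi]`, drift `‖u₀‖ ≤ U`, window multiplier `m ∈ [mlo, mhi]` (window
`w = m τ (N+1)^{-1/3}`, activity normalised by `ε_N/w = σ/(mτ)`) — and the flow quantified
innermost (free by a.e. uniqueness of the hard-sphere flow). These are exactly the parameters of
the periodised, rescaled mesoscopic cells of a local Gibbs profile family (cell of side `L` with `n`
spheres: `σ' = σ ρ̄^{1/3}`, `τ' = τ ρ̄^{1/3}`, `ρ̄` the cell's relative density). Constant activity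
`1` (the canonical law does not depend on it), `Z = Z(σ³)`, `Z' = Z'(σ³)`, no centring
(`∫ ∂ₖφ = 0`). [folklore] -/
def UniformEquilibriumClampedTransferLD : Prop :=
  ∃ η₀ : ℝ, 0 < η₀ ∧ ∀ (σlo σhi θlo θhi U mlo mhi : ℝ),
    0 < σlo → σlo ≤ σhi → σhi < 1 / 2 → σhi ^ 3 ≤ η₀ → 0 < θlo → θlo ≤ θhi → 0 ≤ U →
    0 < mlo → mlo ≤ mhi →
    ∀ φ : T3 → ℝ, Torus.IsSmooth φ →
    ∃ V₀ : ℝ, 0 < V₀ ∧ ∀ V : ℝ, V₀ ≤ V → ∃ β₀ : ℝ, 0 < β₀ ∧ ∀ β : ℝ, |β| ≤ β₀ →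
    ∀ ε : ℝ, 0 < ε → ∃ τ₀ : ℝ, 0 < τ₀ ∧ ∀ τ : ℝ, τ₀ ≤ τ → ∃ N₀ : ℕ, ∀ N : ℕ, N₀ ≤ N →
    ∀ (σ θ₀ m : ℝ) (u₀ : V3), σlo ≤ σ → σ ≤ σhi → θlo ≤ θ₀ → θ₀ ≤ θhi → ‖u₀‖ ≤ U →
      mlo ≤ m → m ≤ mhi →
    ∀ Φ : HardSphereFlow (Torus.geometry (Fin 3)) (hsDiameter σ N) (N + 1),
      (let w : ℝ := m * τ * ((N : ℝ) + 1) ^ (-(1 / 3 : ℝ))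
       let P := localGibbsLaw σ (fun _ => (1 : ℝ)) (fun _ => u₀) (fun _ => θ₀) N Φ
       let Z : ℝ := hsCompressibility (σ ^ 3)
       let Z' : ℝ := deriv hsCompressibility (σ ^ 3)
       let act := fun (i : Fin (N + 1)) (z : Config (N + 1) (Fin 3) T3) =>
         σ / (m * τ) * Φ.collisionSum (Set.Ioc 0 w)
           (fun c => if c.fst = i then ‖c.postVel.1 - c.preVel.1‖ +
             |‖c.postVel.1‖ ^ 2 - ‖c.preVel.1‖ ^ 2| / 2 else 0) z
       let ω := fun (i : Fin (N + 1)) (z : Config (N + 1) (Fin 3) T3) =>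
         if act i z ≤ V then (1 : ℝ) else 0
       let Xm := fun (k : Fin 3) (z : Config (N + 1) (Fin 3) T3) =>
         Φ.collisionSum (Set.Ioc 0 w) (fun c => ω c.fst z * ω c.snd z *
           ((φ c.fstPos - φ c.sndPos) * (c.postVel.1 k - c.preVel.1 k)) / 2) z
       let Am := fun (k : Fin 3) (z : Config (N + 1) (Fin 3) T3) =>
         ∫ r in (0 : ℝ)..w, ∑ i, Torus.partialDeriv k φ ((Φ.flow r z i).1) *
           (θ₀ * σ ^ 3 * Z' + (1 / 3) * (Z - 1) * ‖(Φ.flow r z i).2 - u₀‖ ^ 2)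
       let Xe := fun (z : Config (N + 1) (Fin 3) T3) =>
         Φ.collisionSum (Set.Ioc 0 w) (fun c => ω c.fst z * ω c.snd z *
           ((φ c.fstPos - φ c.sndPos) * ((‖c.postVel.1‖ ^ 2 - ‖c.preVel.1‖ ^ 2) / 2)) / 2) z
       let Ae := fun (z : Config (N + 1) (Fin 3) T3) =>
         ∫ r in (0 : ℝ)..w, ∑ i, ((∑ l, u₀ l * Torus.partialDeriv l φ ((Φ.flow r z i).1)) *
           (θ₀ * σ ^ 3 * Z' + (1 / 3) * (Z - 1) * ‖(Φ.flow r z i).2 - u₀‖ ^ 2) +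
           θ₀ * (Z - 1) * (∑ l, Torus.partialDeriv l φ ((Φ.flow r z i).1) *
             (((Φ.flow r z i).2 - u₀) l)))
       (∀ k : Fin 3, ∫⁻ z, ENNReal.ofReal (Real.exp (β * (w⁻¹ * Xm k z - w⁻¹ * Am k z))) ∂P ≤
           ENNReal.ofReal (Real.exp (ε * ((N : ℝ) + 1)))) ∧
         ∫⁻ z, ENNReal.ofReal (Real.exp (β * (w⁻¹ * Xe z - w⁻¹ * Ae z))) ∂P ≤
           ENNReal.ofReal (Real.exp (ε * ((N : ℝ) + 1))))

/-- The transfer the line would register as `stub_transfer` (together with the census stubs):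
C⁺ together with the mover census implies the crux. Stated as a `Prop` (the remaining hypotheses —
influence census, static decoupling, test-function net — are described in the card and not yet
typed). [folklore] -/
def TransferShape : Prop :=
  UniformEquilibriumClampedTransferLD → MoverCensus →
    OneFlightGossipEngine.LocalClampedTransferLDAlongFamilies

/-- Sanity anchor for the OTHER direction (what is already kernel-checked in the tree, via
`Theorems.ClampedTransferDockBridge.clampedTransferWindowLD_of_family` for the byte-identical heart
twin): the crux implies TwoClocks' C′. Restated as a `Prop` only. [folklore] -/
def ConstantRungShape : Prop :=
  OneFlightGossipEngine.LocalClampedTransferLDAlongFamilies → TwoClocks.ClampedTransferWindowLD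

end Summit.AtomisticToContinuum.HydrodynamicLimit.Cruxes.LocalClampedTransferLDAlongFamilies.IdeatorTwo

end
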